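import Summits.QuantumFields.YangMills.Theorems.BalabanLadderIRColdPurityBridge
import Summits.QuantumFields.YangMills.Theorems.BalabanLadderIRColdDoublingRecursionSC
import Literature.MathematicalPhysics.QuantumFieldTheory.WilsonFinTorusPartitionComplex
import HarnessLib

/-!
# Crux `BalabanLadder.IR` (stmt-QuantumFields-19354) — LINE `jensen-purity-channel` (ideator ym-ir-idea-16 g0, LINE 2;
lens «anomaly» + «assume no gap» structure).  Answers the PRICE of LINE 1 `harmonic-purity-channel` (crit-4 03:16Z: «LOAD Z =
the wall re-typed, STRONGER than E») by LOWERING THE LOAD with a different classical engine.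

SKELETON (2 ≤ stubs ≤ 7; `IR_of` concludes the crux BY NAME, kernel-checked, sorries ONLY inside `stub_*`).

THE LEVER (new relative to LINE 1 and to every other line on this crux): **Poisson–Jensen accounting**.  LINE 1 transports the
subharmonic `log‖1 − h_L‖` (h_L = cold purity ratio `Z_{L³×2⌊L/4⌋}/Z²_{L³×⌊L/4⌋}` of a holomorphic family of complex plaquette
weights) from a Kotecký–Preiss anchor to the Wilson point and therefore FORBIDS every zero of the cold partition function in the
channel.  Here zeros are ALLOWED and PRICED: with `F = Z_t² − Z_{2t}`, `G = Z_t²` (both holomorphic, zeros allowed) the function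
`log‖F‖ − log‖G‖ − Σ_ζ g_Ω(·,ζ)` (sum over the zeros `ζ` of `G` in `Ω = D ∖ B̄(anchor)`, `g_Ω` = Green's function) is subharmonic
on `Ω`, equals `log‖1 − h_L‖` on `∂Ω`, and harmonic-measure majorisation gives at the real target
  `log δᶜ_β(L) ≤ ω·log(C L⁴ e^{−cL}) + (1−ω)·log(1+M) + 2 Σ_ζ g_Ω(β, ζ)`,
so E follows as soon as the GREEN POTENTIAL OF THE INTRUDING ZEROS seen from `β` is `o(L)` — and `g_Ω(β,ζ) ≤ log(R/|ζ−β|)`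
for `D ⊆ B(β,R)`.  By the Poisson–Jensen identity this potential is EXACTLY the «pressure mean-value defect»
`2[∫_{∂Ω} log‖Z_t‖ dω_β − log Z_t(β)] ≥ 0` of the cold torus: the infrared obligation E is re-typed as «the cold log-partition
function at the weak coupling β lies within o(L) of its harmonic boundary average over a channel contour, and the purity ratio is
bounded ON THAT CONTOUR» — boundedness of `h_L` is asked on the boundary curve only, zero-freeness only there.

LOAD `SparseChannel` (XL, weaker than LINE 1's `PurityChannel`: the zero-free case is `s = ∅`): channel data as in LINE 1, but for
`L ≥ L₀` only (i) `Z_t ≠ 0` and `‖h_L‖ ≤ M` on `frontier D`, (ii) a Blaschke-type factorisation `Z_t = g · ∏_{ζ∈s}(z − ζ)` on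
`closure D` with `g` zero-free and a SUBLINEAR Green budget `Σ_{ζ∈s} log(R/‖ζ − β‖) ≤ θ_L·L`, `θ_L → 0`.
`PoissonJensen` (M, classical: Riesz/Poisson–Jensen + a harmonic-measure lower bound; zeros enter through the explicit Blaschke
product, so no measure theory on `∂Ω` is needed in the statement).  `ComplexAnchor` = LINE 1's A VERBATIM (shared statement,
copied here with the currency because crux workfiles are not importable modules).  Seam `stub_exit_of_sparse` (M/L).  X = `AFToColdPressure`, N = `IRnsc` shared as everywhere.  R is PROVED
(`AspectBootstrap.R_holds`) and `ColdPurityBridge.IR_of_bridge` is PROVED, so `SparseChannel ∧ ComplexAnchor ∧ PoissonJensen ⇒ E`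
and `E ∧ R ∧ X ∧ N ⇒ IR`.

HONEST FRAMING.  The Yang–Mills mass gap (Clay) is NOT proved by anything here; R4 (`BalabanUVStability4`) closes only the
conditional finite-𝕋⁴ rung `BalabanLadder.UV`; `IR` stays OPEN behind the XL stubs `stub_sparseChannel` (the infrared wall, typed
lower than LINE 1 but not removed: in every standard scenario Fisher-zero families are extensive, so where LINE 1's load fails this
one fails too) and `stub_afPin`, and the residual `stub_residual`.  This file is SELF-CONTAINED (LINE 1's workfile is not an importable module on the farm): §1 and `ComplexAnchor` are verbatim copies of
LINE 1's currency and anchor statement (one supplier obligation for both lines); it claims no registered stub of another line and is NOT to be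
registered on the crux slot.
Card: `Cruxes/IR/Lines/jensen-purity-channel.md`.
-/

set_option autoImplicit false

noncomputable section

open Filter Topology MeasureTheory
open Literature.MathematicalPhysics.QuantumFieldTheory Literature.MathematicalPhysics.QuantumLattice
open Summit.QuantumFields.YangMills.Cruxes.IR.ColdPressurePincer (AFToColdPressure IRnsc)
open Summit.QuantumFields.YangMills.Cruxes.IR.ColdPurityBridge (ColdExitSC IR_of_bridge)
open Summit.QuantumFields.YangMills.Cruxes.IR.AspectBootstrap (R_holds)

namespace Summit.QuantumFields.YangMills.Cruxes.IR.JensenPurityChannel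

/-! ## §1 Currency (verbatim from LINE 1): cold-torus partition functions with an arbitrary complex plaquette weight -/

section Defs

variable {G : Type} [Group G] [TopologicalSpace G] [IsTopologicalGroup G] [CompactSpace G]
  [MeasurableSpace G] [BorelSpace G]

/-- The partition function of the `Fin`-indexed four-torus `n₀ × n₁ × n₂ × n₃` with an arbitrary complex plaquette weight
`w : G → ℂ` (product of normalised Haar measures over the positively oriented links):
`Z[w](n₀,n₁,n₂,n₃) = ∫ ∏_x ∏_{μ<ν} w(U_{x,μν}) ∏ dHaar`.  For `w = exp(−β (N − Re tr ρ ·))` it is `wilsonFinTorusPartition ρ β`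
(`∏ exp = exp ∑`; part of `stub_exit_of_channel`). -/
def weightFinTorusPartition (w : G → ℂ) (n₀ n₁ n₂ n₃ : ℕ) : ℂ :=
  ∫ U, ∏ x : FinTorusSite n₀ n₁ n₂ n₃, ∏ q : {q : Fin 4 × Fin 4 // q.1 < q.2},
      w (finTorusPlaquette U x q.1.1 q.1.2)
    ∂(Measure.pi fun _ : FinTorusSite n₀ n₁ n₂ n₃ × Fin 4 => haarProbability G)

/-- The complex **purity ratio** of the cold tori of side `L`: `h_L[w] = Z[w](L,L,L,2⌊L/4⌋) / Z[w](L,L,L,⌊L/4⌋)²`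
(= `tr 𝒯^{2t} / (tr 𝒯^t)²` when a transfer operator exists; `1 − h_L` = the cold period-doubling defect `coldDefect` at a real
Wilson weight).  Bulk free energies cancel exactly in it. -/
def purityRatio (w : G → ℂ) (L : ℕ) : ℂ :=
  weightFinTorusPartition w L L L (2 * (L / 4)) / weightFinTorusPartition w L L L (L / 4) ^ 2

/-- The Wilson plaquette weight of the representation `ρ` at COMPLEX coupling `z`: `g ↦ exp(−z (N − Re tr ρ(g)))`. -/
def wilsonWeightC {N : ℕ} (ρ : G →* Matrix (Fin N) (Fin N) ℂ) (z : ℂ) : G → ℂ :=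
  fun g => Complex.exp (-(z * ((((N : ℝ) - (ρ g).trace.re) : ℝ) : ℂ)))

end Defs

/-! ## §1b The Green budget of a finite zero multiset -/

/-- The Green-potential budget of a multiset of zeros `s` seen from the target `zT` inside a disc of radius `R` about `zT`:
`Σ_{ζ∈s} log(R/‖ζ − zT‖)` — an upper bound for `Σ g_Ω(zT, ζ)` whenever `Ω ⊆ B(zT, R)` (domain monotonicity of Green's
function; `g_{B(zT,R)}(zT,ζ) = log(R/‖ζ − zT‖)`). -/
def greenBudget (s : Multiset ℂ) (zT : ℂ) (R : ℝ) : ℝ :=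
  (s.map fun ζ => Real.log (R / ‖ζ - zT‖)).sum

/-- The monic Blaschke-type polynomial `∏_{ζ∈s} (z − ζ)`. -/
def zeroProd (s : Multiset ℂ) (z : ℂ) : ℂ :=
  (s.map fun ζ => z - ζ).prod

/-! ## §2 The statements of the line -/

/-- **LOAD `SparseChannel` (XL — the infrared wall, typed LOWER than LINE 1's `PurityChannel`).**  For compact simple
simply-connected `G`, faithful `r`, anchor tolerance `ε > 0` and every weak coupling `β ≥ β₁(G,r)`: channel data — open sets
`closure D ⊆ U`, `D` bounded, connected, containing a closed anchor disc `B̄(z₀,δ₀)` with `D ∖ B̄(z₀,δ₀)` connected, a target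
`zT ∈ D` off the disc, `D ⊆ B(zT,R)`; a family `w : U → (G → ℂ)` of complex plaquette weights holomorphic in `z`, continuous,
bounded by `B`, `ε`-near the Haar weight on the disc, equal to Wilson's weight of `r` at `β` at `zT`; and a sequence
`θ_L → 0` — such that for all `L ≥ L₀`: (i) ON THE BOUNDARY `frontier D` the cold partition function `Z_t = Z[w_z](L³×⌊L/4⌋)`
has no zero and `‖h_L‖ ≤ M`; (ii) INSIDE, `Z_t = g · ∏_{ζ∈s}(· − ζ)` on `closure D` for a finite multiset `s ⊆ D ∖ {zT}` and a
`g` holomorphic on `U`, zero-free on `closure D`, with Green budget `Σ_{ζ∈s} log(R/‖ζ − zT‖) ≤ θ_L · L`.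
Why it might fail: false exactly where E is false — at a deconfining or bulk wall the zeros of the cold torus form EXTENSIVE
families (count `∝ L⁴` in any fixed box the family crosses; `U(1)₄` pinch at β ≈ 1.01), so the budget is violated by `L³`, not met
by `o(L)`; for `π₁(G) ≠ 1` light flux forces a wall on every channel.  Relative to LINE 1 it tolerates `o(L)`-potential
intruders and asks boundedness/zero-freeness of `h_L` on the contour only. -/
def SparseChannel : Prop :=
  ∀ (G : Type) [Group G] [TopologicalSpace G] [IsTopologicalGroup G] [CompactSpace G],
    IsCompactSimpleLieGroup G → SimplyConnectedSpace G →
    letI : MeasurableSpace G := borel G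
    haveI : BorelSpace G := ⟨rfl⟩
    ∀ r : LatticeRep G, ∀ ε : ℝ, 0 < ε → ∃ β₁ : ℝ, ∀ β : ℝ, β₁ ≤ β →
      ∃ (U D : Set ℂ) (w : ℂ → G → ℂ) (z₀ zT : ℂ) (δ₀ R M B : ℝ) (θ : ℕ → ℝ) (L₀ : ℕ),
        IsOpen U ∧ IsOpen D ∧ Bornology.IsBounded D ∧ IsConnected D ∧ closure D ⊆ U ∧
        0 < δ₀ ∧ Metric.closedBall z₀ δ₀ ⊆ D ∧ IsConnected (D \ Metric.closedBall z₀ δ₀) ∧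
        zT ∈ D ∧ δ₀ < ‖zT - z₀‖ ∧ D ⊆ Metric.ball zT R ∧
        (∀ g : G, DifferentiableOn ℂ (fun z => w z g) U) ∧
        (∀ z ∈ U, Continuous (w z)) ∧
        (∀ z ∈ U, ∀ g : G, ‖w z g‖ ≤ B) ∧
        (∀ z ∈ Metric.closedBall z₀ δ₀, ∀ g : G, ‖w z g - 1‖ ≤ ε) ∧
        w zT = wilsonWeightC r.ρ (β : ℂ) ∧
        Tendsto θ atTop (nhds 0) ∧
        ∀ L : ℕ, L₀ ≤ L →
          (∀ z ∈ frontier D,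
              weightFinTorusPartition (w z) L L L (L / 4) ≠ 0 ∧ ‖purityRatio (w z) L‖ ≤ M) ∧
          ∃ (s : Multiset ℂ) (g : ℂ → ℂ),
            (∀ ζ ∈ s, ζ ∈ D ∧ ζ ≠ zT) ∧
            greenBudget s zT R ≤ θ L * (L : ℝ) ∧
            DifferentiableOn ℂ g U ∧ (∀ z ∈ closure D, g z ≠ 0) ∧
            ∀ z ∈ closure D, weightFinTorusPartition (w z) L L L (L / 4) = g z * zeroProd s z

/-- **`ComplexAnchor` (L — located supplier: complex strong coupling; VERBATIM the statement of LINE 1 `harmonic-purity-channel`, over this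
file's definitionally identical copy of the currency — ONE supplier obligation for both lines).**  There are ABSOLUTE constants `ε₀, C, c > 0`, `L₀`
such that for every compact metrisable group `G` and every continuous complex plaquette weight `w` with `‖w − 1‖∞ ≤ ε₀` the
cold partition function `Z[w](L³×⌊L/4⌋)` is non-zero and `‖1 − h_L[w]‖ ≤ C L⁴ e^{−cL}` for all `L ≥ L₀` (Kotecký–Preiss
polymer expansion of the plaquette gas with activity `w − 1`: bulk clusters cancel in the ratio, only clusters wrapping the
time circle of length `⌊L/4⌋` survive).  The complex-WILSON instance is in tree (`PeriodicBoxFreeEnergyLimits.exists_tube_rate`: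
`‖log Z(N³×t)(z) − t e_N(z)‖ ≤ 12 N³ t e^{−⌊t/2⌋}`, `‖z‖ ≤ r_ρ`); the real instance is `coldDefect_le_of_strongCoupling`. -/
def ComplexAnchor : Prop :=
  ∃ ε₀ C c : ℝ, 0 < ε₀ ∧ 0 < c ∧ ∃ L₀ : ℕ,
    ∀ (G : Type) [Group G] [TopologicalSpace G] [IsTopologicalGroup G] [CompactSpace G]
      [SecondCountableTopology G] [MeasurableSpace G] [BorelSpace G],
      ∀ w : G → ℂ, Continuous w → (∀ g : G, ‖w g - 1‖ ≤ ε₀) →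
        ∀ L : ℕ, L₀ ≤ L →
          weightFinTorusPartition w L L L (L / 4) ≠ 0 ∧
          ‖1 - purityRatio w L‖ ≤ C * (L : ℝ) ^ 4 * Real.exp (-(c * (L : ℝ)))

/-- **`PoissonJensen` (M — classical potential theory, stated without measures).**  Geometry: `closure D ⊆ U` open, `D` open
bounded connected, a closed disc `B̄(z₀,δ₀) ⊆ D` with `Ω := D ∖ B̄(z₀,δ₀)` connected, a target `zT ∈ D` off the disc, `D ⊆ B(zT,R)`.
Then there is `ω ∈ (0,1]` (a lower bound for the harmonic measure of the anchor circle seen from `zT` in `Ω`) such that for all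
`F, g` holomorphic on `U`, `g` zero-free on `closure D`, every finite multiset `s ⊆ Ω ∖ {zT}` and `G := g · ∏_{ζ∈s}(· − ζ)`:
if `‖F‖ ≤ A‖G‖` on `frontier D` and `‖F‖ ≤ a‖G‖` on the circle `sphere z₀ δ₀` (`0 < a ≤ A`), then
`‖F(zT)‖ ≤ a^ω · A^{1−ω} · exp(Σ_{ζ∈s} log(R/‖ζ − zT‖)) · ‖G(zT)‖`.
(Proof in print: `u = log‖F‖ − log‖g‖ − Σ_ζ [log‖· − ζ‖ + g_Ω(·,ζ)]`… precisely `log‖F‖ − log‖G‖ − Σ_ζ g_Ω(·,ζ)` is subharmonic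
on `Ω`, `≤ log a` resp. `≤ log A` on the two boundary parts; two-constants majorisation; `g_Ω(zT,ζ) ≤ log(R/‖ζ − zT‖)` by domain
monotonicity.  Mathlib has the subharmonic ingredients only in pieces — this is a genuine M-sized formalisation stub.) -/
def PoissonJensen : Prop :=
  ∀ (U D : Set ℂ) (z₀ zT : ℂ) (δ₀ R : ℝ),
    IsOpen U → IsOpen D → Bornology.IsBounded D → IsConnected D → closure D ⊆ U →
    0 < δ₀ → Metric.closedBall z₀ δ₀ ⊆ D → IsConnected (D \ Metric.closedBall z₀ δ₀) →
    zT ∈ D → δ₀ < ‖zT - z₀‖ → D ⊆ Metric.ball zT R →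
      ∃ ω : ℝ, 0 < ω ∧ ω ≤ 1 ∧
        ∀ (F g : ℂ → ℂ) (s : Multiset ℂ) (a A : ℝ),
          DifferentiableOn ℂ F U → DifferentiableOn ℂ g U → (∀ z ∈ closure D, g z ≠ 0) →
          (∀ ζ ∈ s, ζ ∈ D ∧ δ₀ < ‖ζ - z₀‖ ∧ ζ ≠ zT) →
          0 < a → a ≤ A →
          (∀ z ∈ frontier D, ‖F z‖ ≤ A * ‖g z * zeroProd s z‖) →
          (∀ z ∈ Metric.sphere z₀ δ₀, ‖F z‖ ≤ a * ‖g z * zeroProd s z‖) →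
            ‖F zT‖ ≤ a ^ ω * A ^ (1 - ω) * Real.exp (greenBudget s zT R) * ‖g zT * zeroProd s zT‖

/-! ## §3 Registered stubs (sorried; each a genuine lemma of the line) -/

/-- LOAD (XL, rank: hardest).  See `SparseChannel`. -/
theorem stub_sparseChannel : SparseChannel := by
  sorry

/-- Located supplier (L): complex strong-coupling purity for a near-Haar plaquette activity (= LINE 1's stub, same statement). -/
theorem stub_complexAnchor : ComplexAnchor := by
  sorry

/-- Classical (M): Poisson–Jensen / Riesz accounting with a harmonic-measure lower bound.  See `PoissonJensen`. -/
theorem stub_poissonJensen : PoissonJensen := by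
  sorry

/-- SEAM (M/L): sparse channel ∧ anchor ∧ Poisson–Jensen ⇒ E.  Per `(G, r)`: `ε := ε₀` of the anchor; for `β ≥ β₁` take the
channel data; `F := Z_t² − Z_{2t}`, `g_G := g²`, `s_G := s + s` (so `G = Z_t²`); on `frontier D`: `‖F‖ ≤ ‖Z_t‖² (1 + ‖h_L‖)
≤ (1+M)‖G‖`; on the anchor circle (⊆ closed disc, weights `ε₀`-near Haar): `‖F‖ = ‖G‖·‖1 − h_L‖ ≤ C L⁴ e^{−cL} ‖G‖` and
`Z_t ≠ 0` there (anchor), so `s` misses the closed disc; `PoissonJensen` ⇒ `‖1 − h_L(zT)‖ ≤ (C L⁴e^{−cL})^ω (1+M)^{1−ω}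
e^{2 θ_L L} → 0`; at `zT` the weight is Wilson's, `h_L` is real in `(0,1]` and `1 − h_L = coldDefect` (`∏ exp = exp ∑`,
`wilsonFinTorusPartition`); `limsup ≤ ε` follows. -/
theorem stub_exit_of_sparse : SparseChannel → ComplexAnchor → PoissonJensen → ColdExitSC := by
  sorry

/-- X (XL, SHARED with lines af-pincer / doubling-bridge / harmonic-purity-channel; not this line's content). -/
theorem stub_afPin : AFToColdPressure := by
  sorry

/-- N (residual, SHARED): the non-simply-connected half of the crux, left open by name. -/
theorem stub_residual : IRnsc := by
  sorry

/-! ## §4 Composition — concludes the crux BY NAME -/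

/-- **`IR_of`**: the six stub STATEMENTS imply `BalabanLadder.IR`:
`E` from (sparse channel, anchor, Poisson–Jensen) by the seam, then the PROVED bridge `IR_of_bridge` with the PROVED `R_holds`. -/
theorem IR_of (hJ : SparseChannel) (hA : ComplexAnchor) (hP : PoissonJensen)
    (hseam : SparseChannel → ComplexAnchor → PoissonJensen → ColdExitSC)
    (hX : AFToColdPressure) (hN : IRnsc) :
    Summit.QuantumFields.YangMills.Theses.BalabanLadder.IR :=
  IR_of_bridge R_holds (hseam hJ hA hP) hX hN

/-- The composition over the six stubs (inherits their sorries; shows the wiring closes the crux by name). -/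
theorem IR_of_stubs : Summit.QuantumFields.YangMills.Theses.BalabanLadder.IR :=
  IR_of stub_sparseChannel stub_complexAnchor stub_poissonJensen stub_exit_of_sparse stub_afPin stub_residual

end Summit.QuantumFields.YangMills.Cruxes.IR.JensenPurityChannel

end
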